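import Literature.NumberTheory.Transcendental.SemialgebraicDerivativeProofs
import Literature.NumberTheory.Transcendental.SemialgebraicMapsProofs
import HarnessLib

/-!
# Increasing enumerations of finite semialgebraic fibres are semialgebraic functions

Let `k → ℝ` be a coefficient ring, `S ⊆ ℝᵃ` and `Z ⊆ ℝᵃ⁺¹` `k`-semialgebraic sets, and suppose
that over every `σ ∈ S` the fibre `{t | (σ, t) ∈ Z}` is finite and enumerated increasingly by
`w₀ σ < w₁ σ < ⋯ < w_{p-1} σ`. Then every `wᵢ` is a `k`-semialgebraic function on `S`
(`isSemialgebraicFunOn_of_strictMono_of_forall_iff`): the graph of `w₀` is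
`{(σ, y) | σ ∈ S, (σ, y) ∈ Z, ∀ t < y, (σ, t) ∉ Z}` and the graph of `w_{i+1}` is
`{(σ, y) | σ ∈ S, (σ, y) ∈ Z, ∃ u, u = wᵢ σ ∧ u < y ∧ ∀ t ∈ (u, y), (σ, t) ∉ Z}`, first-order
formulas over the graph of `wᵢ`, hence semialgebraic over `k` by the Tarski–Seidenberg theorem with
coefficients (`SemialgebraicDerivative.sa_exists` / `sa_forall`, Basu–Pollack–Roy Thm. 2.76,
Cor. 2.78). This is the standard argument that the ordered real roots `ξ₁ < ⋯ < ξ_ℓ` of a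
parametric polynomial over a set where their number is constant are semialgebraic functions
(Basu–Pollack–Roy 2006, proof of Thm. 5.34; Bochnak–Coste–Roy 1998, proof of Thm. 2.3.1), isolated
from polynomials: only the semialgebraicity of the root relation `Z` is used.

The typical root relation is supplied by `isSemialgebraic_setOf_aeval_snoc_comp_eq_zero`: for a
`k`-semialgebraic map `g : S → ℝⁿ` and `q ∈ k[X₀, …, Xₙ]`, the set
`{(σ, t) | σ ∈ S, q(g σ, t) = 0}` is `k`-semialgebraic (composition with a semialgebraic map,
`IsSemialgebraicFunOn.comp_isSemialgebraicMapOn_holds`). Together: the `i`-th real root of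
`t ↦ q(g σ, t)` is a `k`-semialgebraic function of `σ` on any `k`-semialgebraic set over which the
real roots are enumerated increasingly by finitely many functions
(`isSemialgebraicFunOn_root_comp`).

## References

* S. Basu, R. Pollack, M.-F. Roy, *Algorithms in Real Algebraic Geometry*, 2nd ed. (2006),
  Thm. 2.76, Cor. 2.78, Thm. 5.34.
* J. Bochnak, M. Coste, M.-F. Roy, *Real Algebraic Geometry* (1998), Thm. 2.2.1, Prop. 2.2.4,
  Thm. 2.3.1.
-/

noncomputable section

open Set
open Literature.ModelTheory.ExponentialFields
open Literature.NumberTheory.Transcendental.SemialgebraicDerivative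

namespace Literature.NumberTheory.Transcendental

namespace SemialgebraicRootSelection

variable {a p : ℕ}

/-- Order-theoretic description of the least element of an increasing enumeration: `y = w₀ σ` iff
`y` is in the fibre and nothing below `y` is. [folklore] -/
theorem eq_apply_zero_iff {Z : Set (Fin (a + 1) → ℝ)} {w : Fin p → (Fin a → ℝ) → ℝ}
    {σ : Fin a → ℝ} (hmono : StrictMono fun i => w i σ)
    (hiff : ∀ t : ℝ, Fin.snoc σ t ∈ Z ↔ ∃ i, t = w i σ) (hp : 0 < p) (y : ℝ) :
    y = w ⟨0, hp⟩ σ ↔ Fin.snoc σ y ∈ Z ∧ ∀ t, t < y → Fin.snoc σ t ∉ Z := by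
  constructor
  · rintro rfl
    refine ⟨(hiff _).2 ⟨_, rfl⟩, fun t ht htZ => ?_⟩
    obtain ⟨j, rfl⟩ := (hiff t).1 htZ
    have h : j < ⟨0, hp⟩ := hmono.lt_iff_lt.1 ht
    rw [Fin.lt_def] at h
    exact absurd h (Nat.not_lt_zero _)
  · rintro ⟨hy, hbelow⟩
    obtain ⟨j, rfl⟩ := (hiff y).1 hy
    by_contra hne
    have hlt : (⟨0, hp⟩ : Fin p) < j := by
      rcases lt_or_eq_of_le (Fin.mk_le_mk.2 (Nat.zero_le j.1) : (⟨0, hp⟩ : Fin p) ≤ j) with h | h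
      · exact h
      · exact absurd (congrArg (fun i => w i σ) h).symm hne
    exact hbelow _ (hmono hlt) ((hiff _).2 ⟨_, rfl⟩)

/-- Order-theoretic description of the successor in an increasing enumeration: `y = w_{i+1} σ` iff
`y` is in the fibre, `wᵢ σ < y`, and nothing strictly between `wᵢ σ` and `y` is in the fibre.
[folklore] -/
theorem eq_apply_succ_iff {Z : Set (Fin (a + 1) → ℝ)} {w : Fin p → (Fin a → ℝ) → ℝ}
    {σ : Fin a → ℝ} (hmono : StrictMono fun i => w i σ)
    (hiff : ∀ t : ℝ, Fin.snoc σ t ∈ Z ↔ ∃ i, t = w i σ) {i : ℕ} (hi : i + 1 < p) (y : ℝ) :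
    y = w ⟨i + 1, hi⟩ σ ↔ Fin.snoc σ y ∈ Z ∧ w ⟨i, Nat.lt_of_succ_lt hi⟩ σ < y ∧
      ∀ t, w ⟨i, Nat.lt_of_succ_lt hi⟩ σ < t → t < y → Fin.snoc σ t ∉ Z := by
  constructor
  · rintro rfl
    refine ⟨(hiff _).2 ⟨_, rfl⟩, hmono (Fin.mk_lt_mk.2 i.lt_succ_self), fun t ht hty htZ => ?_⟩
    obtain ⟨j, rfl⟩ := (hiff t).1 htZ
    have h1 : (⟨i, Nat.lt_of_succ_lt hi⟩ : Fin p) < j := hmono.lt_iff_lt.1 ht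
    have h2 : j < ⟨i + 1, hi⟩ := hmono.lt_iff_lt.1 hty
    rw [Fin.lt_def] at h1 h2
    simp only at h1 h2
    omega
  · rintro ⟨hy, hlt, hbetween⟩
    obtain ⟨j, rfl⟩ := (hiff y).1 hy
    have h1 : (⟨i, Nat.lt_of_succ_lt hi⟩ : Fin p) < j := hmono.lt_iff_lt.1 hlt
    rw [Fin.lt_def] at h1
    simp only at h1
    rcases Nat.lt_or_ge (i + 1) j.1 with h | h
    · exact absurd ((hiff _).2 ⟨⟨i + 1, hi⟩, rfl⟩)
        (hbetween _ (hmono (Fin.mk_lt_mk.2 i.lt_succ_self)) (hmono (Fin.mk_lt_mk.2 h)))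
    · congr 1
      exact Fin.ext (by simp only; omega)

variable {k : Type*} [CommRing k] [Algebra k ℝ]

/-- The graph of the least element `w₀` of the enumeration is `k`-semialgebraic.
[cite: BasuPollackRoy2006, Thm. 5.34] -/
theorem isSemialgebraicFunOn_zero {S : Set (Fin a → ℝ)} (hS : IsSemialgebraic k S)
    {Z : Set (Fin (a + 1) → ℝ)} (hZ : IsSemialgebraic k Z) {w : Fin p → (Fin a → ℝ) → ℝ}
    (hmono : ∀ σ ∈ S, StrictMono fun i => w i σ)
    (hiff : ∀ σ ∈ S, ∀ t : ℝ, Fin.snoc σ t ∈ Z ↔ ∃ i, t = w i σ) (hp : 0 < p) :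
    IsSemialgebraicFunOn k S (w ⟨0, hp⟩) := by
  rw [isSemialgebraicFunOn_iff]
  have hbelow : IsSemialgebraic k {v : Fin (a + 1) → ℝ |
      ∀ t : ℝ, t < v (Fin.last a) → Fin.snoc (Fin.init v) t ∉ Z} := by
    refine sa_forall (sa_imp (sa_lt _ _) ?_)
    convert (sa_reindex (P := (· ∈ Z)) hZ
      (Fin.snoc (fun i : Fin a => (Fin.castSucc i).castSucc) (Fin.last (a + 1)))).compl using 1
    ext v
    simp only [mem_setOf_eq, mem_compl_iff]
    exact Iff.of_eq (congrArg (fun z => z ∉ Z) (funext fun i => by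
      refine Fin.lastCases ?_ (fun j => ?_) i <;> simp [Fin.init]))
  convert hS.setOf_init_mem.inter (hZ.inter hbelow) using 1
  ext v
  simp only [mem_setOf_eq, mem_inter_iff]
  constructor
  · rintro ⟨hv, hy⟩
    have h := (eq_apply_zero_iff (hmono _ hv) (hiff _ hv) hp (v (Fin.last a))).1 hy
    rw [Fin.snoc_init_self] at h
    exact ⟨hv, h⟩
  · rintro ⟨hv, hZv, hb⟩
    refine ⟨hv, (eq_apply_zero_iff (hmono _ hv) (hiff _ hv) hp (v (Fin.last a))).2 ⟨?_, hb⟩⟩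
    rwa [Fin.snoc_init_self]

/-- The graph of `w_{i+1}` is `k`-semialgebraic if the graph of `wᵢ` is.
[cite: BasuPollackRoy2006, Thm. 5.34] -/
theorem isSemialgebraicFunOn_succ {S : Set (Fin a → ℝ)} (hS : IsSemialgebraic k S)
    {Z : Set (Fin (a + 1) → ℝ)} (hZ : IsSemialgebraic k Z) {w : Fin p → (Fin a → ℝ) → ℝ}
    (hmono : ∀ σ ∈ S, StrictMono fun i => w i σ)
    (hiff : ∀ σ ∈ S, ∀ t : ℝ, Fin.snoc σ t ∈ Z ↔ ∃ i, t = w i σ) {i : ℕ} (hi : i + 1 < p)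
    (ih : IsSemialgebraicFunOn k S (w ⟨i, Nat.lt_of_succ_lt hi⟩)) :
    IsSemialgebraicFunOn k S (w ⟨i + 1, hi⟩) := by
  rw [isSemialgebraicFunOn_iff] at ih ⊢
  -- the matrix `∃ u, (σ ∈ S ∧ u = wᵢ σ) ∧ u < y ∧ ∀ t, u < t → t < y → (σ, t) ∉ Z`
  have hex : IsSemialgebraic k {v : Fin (a + 1) → ℝ | ∃ u : ℝ,
      (Fin.init v ∈ S ∧ u = w ⟨i, Nat.lt_of_succ_lt hi⟩ (Fin.init v)) ∧ u < v (Fin.last a) ∧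
        ∀ t : ℝ, u < t → t < v (Fin.last a) → Fin.snoc (Fin.init v) t ∉ Z} := by
    refine sa_exists (sa_and ?_ (sa_and (sa_lt _ _) (sa_forall (sa_imp (sa_lt _ _)
      (sa_imp (sa_lt _ _) ?_)))))
    · convert sa_graph₁ ih (fun j : Fin a => (Fin.castSucc j).castSucc) (Fin.last (a + 1))
        using 1
      ext v
      exact Iff.rfl
    · convert (sa_reindex (P := (· ∈ Z)) hZ
        (Fin.snoc (fun j : Fin a => ((Fin.castSucc j).castSucc).castSucc) (Fin.last (a + 2)))).compl
        using 1
      ext v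
      simp only [mem_setOf_eq, mem_compl_iff]
      exact Iff.of_eq (congrArg (fun z => z ∉ Z) (funext fun j => by
        refine Fin.lastCases ?_ (fun j' => ?_) j <;> simp [Fin.init]))
  convert hS.setOf_init_mem.inter (hZ.inter hex) using 1
  ext v
  simp only [mem_setOf_eq, mem_inter_iff]
  constructor
  · rintro ⟨hv, hy⟩
    have h := (eq_apply_succ_iff (hmono _ hv) (hiff _ hv) hi (v (Fin.last a))).1 hy
    rw [Fin.snoc_init_self] at h
    exact ⟨hv, h.1, _, ⟨hv, rfl⟩, h.2.1, h.2.2⟩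
  · rintro ⟨hv, hZv, u, ⟨-, rfl⟩, hlt, hb⟩
    refine ⟨hv, (eq_apply_succ_iff (hmono _ hv) (hiff _ hv) hi (v (Fin.last a))).2
      ⟨?_, hlt, hb⟩⟩
    rwa [Fin.snoc_init_self]

end SemialgebraicRootSelection

open SemialgebraicRootSelection

variable {k : Type*} [CommRing k] [Algebra k ℝ] {a p : ℕ}

/-- **Increasing enumerations of finite semialgebraic fibres are semialgebraic.** If `S ⊆ ℝᵃ` and
`Z ⊆ ℝᵃ⁺¹` are `k`-semialgebraic and over every `σ ∈ S` the fibre `{t | (σ, t) ∈ Z}` is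
`{w₀ σ < ⋯ < w_{p-1} σ}`, then each `wᵢ` is a `k`-semialgebraic function on `S` (its graph is
first-order definable from `Z` and the graph of `w_{i-1}` without parameters; Tarski–Seidenberg
with coefficients in `k`). [cite: BasuPollackRoy2006, Thm. 5.34] -/
theorem isSemialgebraicFunOn_of_strictMono_of_forall_iff {S : Set (Fin a → ℝ)}
    (hS : IsSemialgebraic k S) {Z : Set (Fin (a + 1) → ℝ)} (hZ : IsSemialgebraic k Z)
    {w : Fin p → (Fin a → ℝ) → ℝ} (hmono : ∀ σ ∈ S, StrictMono fun i => w i σ)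
    (hiff : ∀ σ ∈ S, ∀ t : ℝ, Fin.snoc σ t ∈ Z ↔ ∃ i, t = w i σ) (i : Fin p) :
    IsSemialgebraicFunOn k S (w i) := by
  suffices h : ∀ n : ℕ, ∀ hn : n < p, IsSemialgebraicFunOn k S (w ⟨n, hn⟩) from h i.1 i.2
  intro n
  induction n with
  | zero => exact fun hn => isSemialgebraicFunOn_zero hS hZ hmono hiff hn
  | succ n ihn => exact fun hn => isSemialgebraicFunOn_succ hS hZ hmono hiff hn (ihn _)

/-- The root relation of a polynomial over `k` after a `k`-semialgebraic map is `k`-semialgebraic: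
for `g` semialgebraic on `S ⊆ ℝᵃ` with values in `ℝⁿ` and `q ∈ k[X₀, …, Xₙ]`, the set
`{(σ, t) | σ ∈ S, q(g σ, t) = 0} ⊆ ℝᵃ⁺¹` (pairs realised by `Fin.snoc`) is `k`-semialgebraic.
[cite: BochnakCosteRoy1998, Prop. 2.2.6] -/
theorem isSemialgebraic_setOf_aeval_snoc_comp_eq_zero {n : ℕ} {S : Set (Fin a → ℝ)}
    (hS : IsSemialgebraic k S) {g : (Fin a → ℝ) → (Fin n → ℝ)} (hg : IsSemialgebraicMapOn k S g)
    (q : MvPolynomial (Fin (n + 1)) k) :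
    IsSemialgebraic k {v : Fin (a + 1) → ℝ | Fin.init v ∈ S ∧
      MvPolynomial.aeval (Fin.snoc (g (Fin.init v)) (v (Fin.last a)) : Fin (n + 1) → ℝ) q = 0} := by
  -- the map `(σ, t) ↦ (g σ, t)` is semialgebraic on the cylinder `S × ℝ`
  have hcyl : IsSemialgebraic k {v : Fin (a + 1) → ℝ | Fin.init v ∈ S} := hS.setOf_init_mem
  have hG : IsSemialgebraicMapOn k {v : Fin (a + 1) → ℝ | Fin.init v ∈ S}
      (fun v => (Fin.snoc (g (Fin.init v)) (v (Fin.last a)) : Fin (n + 1) → ℝ)) := by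
    refine IsSemialgebraicMapOn.of_forall hcyl fun j => ?_
    refine Fin.lastCases ?_ (fun j' => ?_) j
    · simp only [Fin.snoc_last]
      exact (isSemialgebraicFunOn_aeval hcyl (MvPolynomial.X (Fin.last a))).congr
        fun v _ => by simp
    · simp only [Fin.snoc_castSucc]
      exact ((isSemialgebraicMapOn_iff_forall_holds hS).1 hg j').comp_init
  have hF : IsSemialgebraicFunOn k {v : Fin (a + 1) → ℝ | Fin.init v ∈ S}
      (fun v => MvPolynomial.aeval
        (Fin.snoc (g (Fin.init v)) (v (Fin.last a)) : Fin (n + 1) → ℝ) q) :=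
    IsSemialgebraicFunOn.comp_isSemialgebraicMapOn_holds
      (isSemialgebraicFunOn_aeval isSemialgebraic_univ q) hG (mapsTo_univ _ _)
  have hT : IsSemialgebraic k {u : Fin (a + 1 + 1) → ℝ | u (Fin.last (a + 1)) = 0} := by
    simpa using isSemialgebraic_setOf_eval_eq_zero (k := k) (R := ℝ)
      (MvPolynomial.X (Fin.last (a + 1)) : MvPolynomial (Fin (a + 1 + 1)) k)
  convert hF.isSemialgebraic_sep_snoc_mem tarski_seidenberg_real_holds hT using 1
  ext v
  simp

/-- **Ordered real roots of a polynomial along a semialgebraic map are semialgebraic functions.**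
Let `g` be a `k`-semialgebraic map on a `k`-semialgebraic `S ⊆ ℝᵃ` with values in `ℝⁿ`,
`q ∈ k[X₀, …, Xₙ]`, and suppose that for every `σ ∈ S` the real roots of `t ↦ q(g σ, t)` are
exactly `w₀ σ < ⋯ < w_{p-1} σ`. Then every `wᵢ` is `k`-semialgebraic on `S`.
[cite: BasuPollackRoy2006, Thm. 5.34] -/
theorem isSemialgebraicFunOn_root_comp {n : ℕ} {S : Set (Fin a → ℝ)} (hS : IsSemialgebraic k S)
    {g : (Fin a → ℝ) → (Fin n → ℝ)} (hg : IsSemialgebraicMapOn k S g)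
    (q : MvPolynomial (Fin (n + 1)) k) {w : Fin p → (Fin a → ℝ) → ℝ}
    (hmono : ∀ σ ∈ S, StrictMono fun i => w i σ)
    (hiff : ∀ σ ∈ S, ∀ t : ℝ,
      MvPolynomial.aeval (Fin.snoc (g σ) t : Fin (n + 1) → ℝ) q = 0 ↔ ∃ i, t = w i σ)
    (i : Fin p) : IsSemialgebraicFunOn k S (w i) := by
  refine isSemialgebraicFunOn_of_strictMono_of_forall_iff hS
    (isSemialgebraic_setOf_aeval_snoc_comp_eq_zero hS hg q) hmono (fun σ hσ t => ?_) i
  simp only [mem_setOf_eq, Fin.init_snoc, Fin.snoc_last]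
  exact ⟨fun h => (hiff σ hσ t).1 h.2, fun h => ⟨hσ, (hiff σ hσ t).2 h⟩⟩

end Literature.NumberTheory.Transcendental
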